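/-
Copyright: harness cell b2b-lgcu-borel (gen 14).  Honest framing: the VALUE here is a THEOREM (a
master volume floor and the order window of the `(m,k) = (2,1)` cell of the crux) — NOT summit
progress; the crux item `SubgroupIdentityDesigns` (stmt-MatrixMultiplication-14079) stays open.
-/
import Summits.MatrixMultiplication.MatrixMultiplication.Theorems.SubgroupIdentityDesigns.Negative.DecoratedSylowNoGo
import Summits.MatrixMultiplication.MatrixMultiplication.Theorems.SubgroupIdentityDesigns.Negative.StandardLines

/-!
# The master level-one volume floor of `GL₂(𝔽_p)` and the order window of a `(2,1)` witness

The exact level-one floor `f(s) = 1 + p^s + (p-2)(p+1)^s ≤ budget p 2 1 s`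
(`DecoratedSylowNoGo.budget_two_ge`) is an `ℓ^s`-sum of the `p` level-one degrees `1, p, p+1 (×(p-2))`,
so `s ↦ f(s)^{1/s}` is non-increasing: for `0 < s ≤ 3`, `f(3)^{s/3} ≤ f(s)`
(`rpow_le_floor_of_le_floor_three`, proved as `x^r ≤ A^{r-1} x` termwise, `r = 3/s ≥ 1`).  Hence the
MASTER FLOOR of the `(m,k) = (2,1)` cell (`no_levelOne_witness_of_volume_le`): a subgroup triple with
`|H₁||H₂||H₃| ≤ f(3) = 1 + p³ + (p-2)(p+1)³ = p⁴ + 2p³ - 3p² - 5p - 1`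
never satisfies the crux inequality `budget p 2 1 (2+ε) < V^{(2+ε)/3}`, for ANY prime `p` and ANY
`-2 < ε ≤ 1` — no TPP and no design needed (this subsumes `rpow_volume_le_floor`, whose hypothesis
`V ≤ p³(p-1)` is below `f(3)`).

Combined with the in-tree pair walls `|Hᵢ||Hⱼ| + 2p ≤ (p+1)(p²-1)` forced by a level-one identity
design on a TPP triple (`StandardLines.no_levelOne_design_of_walls`) this gives, for `p ≥ 3`
(`p·((p+1)(p²-1) - 2p) = p⁴ + p³ - 3p² - p ≤ f(3)`, margin `p³ - 4p - 1 ≥ 14`):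
* `no_levelOne_witness_of_small_member`: NO `(2,1)` witness has a member of order `≤ p`;
* `levelOne_witness_window`: every member of a `(2,1)` witness at `-2 < ε ≤ 1` has
  `p + 1 ≤ |Hᵢ| ≤ p² - 3`.
(`p = 2`, where `|GL₂(𝔽₂)| = 6`, is covered for `0 < ε ≤ 1` by
`LevelOneDimSqueeze.no_levelOne_witness_small_eps`.)

Scope, honestly: level `k = 1`, `m = 2` only; the order window is a census constraint, not a
refutation of the cell.  Report: `run/shared/lean/b2b/levelgraded-cu/ORACLE-g14.md` §G14-1.
Sorry-free; no new definitions.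
-/

set_option linter.dupNamespace false

noncomputable section

open scoped BigOperators Classical
open Summit.MatrixMultiplication.MatrixMultiplication.Theorems.LieRankDesigns.Negative (GLm Mat budget)

namespace Summit.MatrixMultiplication.MatrixMultiplication.Theorems.SubgroupIdentityDesigns.Negative

section LevelOneFloor

open Literature.Barriers.MatrixMultiplication (SubgroupTPP)

variable {p : ℕ} [hp : Fact p.Prime]

omit hp in
/-- The `ℓ^s`-monotonicity step: `0 ≤ x ≤ A` and `1 ≤ r` give `x^r ≤ A^{r-1} · x`. -/
theorem rpow_le_rpow_sub_one_mul {x A r : ℝ} (hx : 0 ≤ x) (hxA : x ≤ A) (hr : 1 ≤ r) :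
    x ^ r ≤ A ^ (r - 1) * x := by
  have e : x ^ r = x ^ (r - 1) * x := by
    have h := Real.rpow_add' hx (show (r - 1) + 1 ≠ 0 by linarith)
    rw [sub_add_cancel, Real.rpow_one] at h
    exact h
  rw [e]
  exact mul_le_mul_of_nonneg_right (Real.rpow_le_rpow hx hxA (by linarith)) hx

/-- **THE MASTER LEVEL-ONE FLOOR (`ℓ^s`-monotonicity of the level-one degrees).**  For
`0 < s ≤ 3` and a real `0 ≤ V ≤ 1 + p³ + (p-2)(p+1)³`: `V^{s/3} ≤ 1 + p^s + (p-2)(p+1)^s`. -/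
theorem rpow_le_floor_of_le_floor_three {V : ℝ} (hV0 : 0 ≤ V)
    (hV : V ≤ 1 + (p : ℝ) ^ 3 + ((p : ℝ) - 2) * ((p : ℝ) + 1) ^ 3) {s : ℝ} (hs0 : 0 < s)
    (hs3 : s ≤ 3) :
    V ^ (s / 3) ≤ 1 + (p : ℝ) ^ s + ((p : ℝ) - 2) * ((p : ℝ) + 1) ^ s := by
  have hp2 : 2 ≤ p := hp.out.two_le
  have hpR : (2 : ℝ) ≤ p := by exact_mod_cast hp2
  have hp0 : (0 : ℝ) ≤ p := by linarith
  have hq0 : (0 : ℝ) ≤ (p : ℝ) + 1 := by linarith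
  set A : ℝ := 1 + (p : ℝ) ^ s + ((p : ℝ) - 2) * ((p : ℝ) + 1) ^ s with hA
  have hx2 : 0 ≤ (p : ℝ) ^ s := Real.rpow_nonneg hp0 s
  have hx3 : 0 ≤ ((p : ℝ) + 1) ^ s := Real.rpow_nonneg hq0 s
  have hw : 0 ≤ (p : ℝ) - 2 := by linarith
  have hwx3 : 0 ≤ ((p : ℝ) - 2) * ((p : ℝ) + 1) ^ s := mul_nonneg hw hx3
  have h1A : (1 : ℝ) ≤ A := by rw [hA]; linarith
  have h2A : (p : ℝ) ^ s ≤ A := by rw [hA]; linarith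
  have hA0 : 0 ≤ A := by linarith
  set r : ℝ := 3 / s with hr
  have hr1 : 1 ≤ r := by
    rw [hr, le_div_iff₀ hs0]
    linarith
  have hAr0 : 0 ≤ A ^ (r - 1) := Real.rpow_nonneg hA0 _
  -- the three terms of `f(3)` as `r`-th powers of the terms of `f(s) = A`
  have e1 : (1 : ℝ) = (1 : ℝ) ^ r := (Real.one_rpow r).symm
  have hsr : s * r = ((3 : ℕ) : ℝ) := by
    rw [hr, mul_div_cancel₀ (3 : ℝ) hs0.ne']
    norm_num
  have e2 : (p : ℝ) ^ 3 = ((p : ℝ) ^ s) ^ r := by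
    rw [← Real.rpow_mul hp0, hsr, Real.rpow_natCast]
  have e3 : ((p : ℝ) + 1) ^ 3 = (((p : ℝ) + 1) ^ s) ^ r := by
    rw [← Real.rpow_mul hq0, hsr, Real.rpow_natCast]
  -- termwise `x^r ≤ A^{r-1} x`
  have t1 : (1 : ℝ) ^ r ≤ A ^ (r - 1) * 1 := rpow_le_rpow_sub_one_mul zero_le_one h1A hr1
  have t2 : ((p : ℝ) ^ s) ^ r ≤ A ^ (r - 1) * (p : ℝ) ^ s := rpow_le_rpow_sub_one_mul hx2 h2A hr1
  have t3 : ((p : ℝ) - 2) * (((p : ℝ) + 1) ^ s) ^ r ≤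
      ((p : ℝ) - 2) * (A ^ (r - 1) * ((p : ℝ) + 1) ^ s) := by
    by_cases h2 : (p : ℝ) - 2 = 0
    · rw [h2, zero_mul, zero_mul]
    · have h3 : 3 ≤ p := by
        by_contra h'
        have hp2' : p = 2 := by omega
        apply h2
        rw [hp2']
        norm_num
      have h3R : (3 : ℝ) ≤ p := by exact_mod_cast h3
      have h3A : ((p : ℝ) + 1) ^ s ≤ A := by
        have hm : 1 * ((p : ℝ) + 1) ^ s ≤ ((p : ℝ) - 2) * ((p : ℝ) + 1) ^ s :=
          mul_le_mul_of_nonneg_right (by linarith) hx3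
        rw [one_mul] at hm
        rw [hA]
        linarith
      exact mul_le_mul_of_nonneg_left (rpow_le_rpow_sub_one_mul hx3 h3A hr1) hw
  have key : 1 + (p : ℝ) ^ 3 + ((p : ℝ) - 2) * ((p : ℝ) + 1) ^ 3 ≤ A ^ r := by
    have eA : A ^ (r - 1) * A = A ^ r := by
      have h := Real.rpow_add' hA0 (show (r - 1) + 1 ≠ 0 by linarith)
      rw [sub_add_cancel, Real.rpow_one] at h
      exact h.symm
    calc 1 + (p : ℝ) ^ 3 + ((p : ℝ) - 2) * ((p : ℝ) + 1) ^ 3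
        = (1 : ℝ) ^ r + ((p : ℝ) ^ s) ^ r + ((p : ℝ) - 2) * (((p : ℝ) + 1) ^ s) ^ r := by
          rw [← e1, ← e2, ← e3]
      _ ≤ A ^ (r - 1) * 1 + A ^ (r - 1) * (p : ℝ) ^ s +
            ((p : ℝ) - 2) * (A ^ (r - 1) * ((p : ℝ) + 1) ^ s) := by linarith
      _ = A ^ (r - 1) * A := by
          rw [hA]
          ring
      _ = A ^ r := eA
  have hrs : r * (s / 3) = 1 := by
    rw [hr]
    field_simp
  calc V ^ (s / 3) ≤ (A ^ r) ^ (s / 3) := Real.rpow_le_rpow hV0 (hV.trans key) (by linarith)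
    _ = A := by rw [← Real.rpow_mul hA0, hrs, Real.rpow_one]

/-- The floor `1 + p³ + (p-2)(p+1)³` cast to `ℝ`. -/
theorem natCast_floor_three :
    ((1 + p ^ 3 + (p - 2) * (p + 1) ^ 3 : ℕ) : ℝ) =
      1 + (p : ℝ) ^ 3 + ((p : ℝ) - 2) * ((p : ℝ) + 1) ^ 3 := by
  push_cast [Nat.cast_sub hp.out.two_le]
  ring

/-- **NO LEVEL-ONE WITNESS OF VOLUME AT MOST THE FLOOR** (`GL₂(𝔽_p)`, any prime `p`, any
`-2 < ε ≤ 1`): if `|H₁||H₂||H₃| ≤ 1 + p³ + (p-2)(p+1)³` (as reals) then the crux inequality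
`budget p 2 1 (2+ε) < (|H₁||H₂||H₃|)^{(2+ε)/3}` FAILS — no TPP and no identity design needed. -/
theorem no_levelOne_witness_of_volume_le {ε : ℝ} (hε : -2 < ε) (hε1 : ε ≤ 1)
    {H₁ H₂ H₃ : Subgroup (GLm p 2)}
    (hV : ((Nat.card H₁ * Nat.card H₂ * Nat.card H₃ : ℕ) : ℝ) ≤
      1 + (p : ℝ) ^ 3 + ((p : ℝ) - 2) * ((p : ℝ) + 1) ^ 3) :
    ¬ budget p 2 1 (2 + ε) <
      ((Nat.card H₁ * Nat.card H₂ * Nat.card H₃ : ℕ) : ℝ) ^ ((2 + ε) / 3) :=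
  not_lt.2 ((rpow_le_floor_of_le_floor_three (Nat.cast_nonneg _) hV (s := 2 + ε) (by linarith)
    (by linarith)).trans (budget_two_ge (2 + ε)))

/-- The same with the natural-number hypothesis `|H₁||H₂||H₃| ≤ 1 + p³ + (p-2)(p+1)³`
(`= p⁴ + 2p³ - 3p² - 5p - 1`; e.g. `9, 161, 849, 2925, 17841, 33305` at `p = 2, 3, 5, 7, 11, 13`). -/
theorem no_levelOne_witness_of_volume_le_nat {ε : ℝ} (hε : -2 < ε) (hε1 : ε ≤ 1)
    {H₁ H₂ H₃ : Subgroup (GLm p 2)}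
    (hV : Nat.card H₁ * Nat.card H₂ * Nat.card H₃ ≤ 1 + p ^ 3 + (p - 2) * (p + 1) ^ 3) :
    ¬ budget p 2 1 (2 + ε) <
      ((Nat.card H₁ * Nat.card H₂ * Nat.card H₃ : ℕ) : ℝ) ^ ((2 + ε) / 3) := by
  refine no_levelOne_witness_of_volume_le hε hε1 ?_
  rw [← natCast_floor_three]
  exact_mod_cast hV

omit hp in
/-- Arithmetic of the small-member case (`p ≥ 3`): `c₁ ≤ p` and the wall
`c₂ c₃ + 2p ≤ (p+1)(p²-1)` give `c₁ c₂ c₃ ≤ p⁴ + p³ - 3p² - p ≤ 1 + p³ + (p-2)(p+1)³`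
(margin `p³ - 4p - 1 ≥ 14`). -/
theorem natCast_mul_le_floor_of_wall (hp3 : 3 ≤ p) {c₁ c₂ c₃ : ℕ} (h1 : c₁ ≤ p)
    (h23 : c₂ * c₃ + 2 * p ≤ (p + 1) * (p ^ 2 - 1)) :
    ((c₁ * c₂ * c₃ : ℕ) : ℝ) ≤ 1 + (p : ℝ) ^ 3 + ((p : ℝ) - 2) * ((p : ℝ) + 1) ^ 3 := by
  have hp3R : (3 : ℝ) ≤ p := by exact_mod_cast hp3
  have h1R : (c₁ : ℝ) ≤ p := by exact_mod_cast h1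
  have hp21 : 1 ≤ p ^ 2 := Nat.one_le_pow _ _ (by omega)
  have h23R : (c₂ : ℝ) * c₃ + 2 * p ≤ ((p : ℝ) + 1) * ((p : ℝ) ^ 2 - 1) := by
    have h := (Nat.cast_le (α := ℝ)).2 h23
    push_cast [Nat.cast_sub hp21] at h
    exact h
  have hc₂ : (0 : ℝ) ≤ c₂ := Nat.cast_nonneg _
  have hc₃ : (0 : ℝ) ≤ c₃ := Nat.cast_nonneg _
  have hc₂₃ : (0 : ℝ) ≤ (c₂ : ℝ) * c₃ := mul_nonneg hc₂ hc₃
  have hA : (c₁ : ℝ) * c₂ * c₃ ≤ (p : ℝ) * ((c₂ : ℝ) * c₃) := by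
    rw [mul_assoc]
    exact mul_le_mul_of_nonneg_right h1R hc₂₃
  have hB : (p : ℝ) * ((c₂ : ℝ) * c₃) ≤ (p : ℝ) * (((p : ℝ) + 1) * ((p : ℝ) ^ 2 - 1) - 2 * p) :=
    mul_le_mul_of_nonneg_left (by linarith) (by linarith)
  have hC : (p : ℝ) * (((p : ℝ) + 1) * ((p : ℝ) ^ 2 - 1) - 2 * p) ≤
      1 + (p : ℝ) ^ 3 + ((p : ℝ) - 2) * ((p : ℝ) + 1) ^ 3 := by
    nlinarith [mul_nonneg (mul_nonneg (sub_nonneg.2 hp3R) (by linarith : (0 : ℝ) ≤ p))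
      (by linarith : (0 : ℝ) ≤ p)]
  push_cast
  linarith

/-- **NO `(2,1)` WITNESS WITH A MEMBER OF ORDER `≤ p`** (`p ≥ 3`, any `-2 < ε ≤ 1`).  A
subgroup-TPP triple of `GL₂(𝔽_p)` carrying a level-one identity design obeys the three pair walls
`|Hᵢ||Hⱼ| + 2p ≤ (p+1)(p²-1)` (`StandardLines.no_levelOne_design_of_walls`); if moreover some
`|Hᵢ| ≤ p` then `|H₁||H₂||H₃| ≤ p((p+1)(p²-1) - 2p) ≤ 1 + p³ + (p-2)(p+1)³`, below the floor. -/
theorem no_levelOne_witness_of_small_member (hp3 : 3 ≤ p) {ε : ℝ} (hε : -2 < ε) (hε1 : ε ≤ 1)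
    {H₁ H₂ H₃ : Subgroup (GLm p 2)} (htpp : SubgroupTPP H₁ H₂ H₃)
    (hdes : ∃ c : Matrix (Fin 2) (Fin 2) (ZMod p) → ℂ, (∀ M, 1 < M.rank → c M = 0) ∧
      (∑ M, c M * ZMod.stdAddChar (Matrix.trace (M * ((1 : GLm p 2) : Mat p 2)))) = 1 ∧
      ∀ a ∈ H₁, ∀ b ∈ H₂, ∀ g ∈ H₃, a * b * g ≠ 1 →
        (∑ M, c M * ZMod.stdAddChar
          (Matrix.trace (M * ((a * b * g : GLm p 2) : Mat p 2)))) = 0)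
    (hsmall : Nat.card H₁ ≤ p ∨ Nat.card H₂ ≤ p ∨ Nat.card H₃ ≤ p) :
    ¬ budget p 2 1 (2 + ε) <
      ((Nat.card H₁ * Nat.card H₂ * Nat.card H₃ : ℕ) : ℝ) ^ ((2 + ε) / 3) := by
  refine no_levelOne_witness_of_volume_le hε hε1 ?_
  have hw := StandardLines.no_levelOne_design_of_walls H₁ H₂ H₃ htpp
  have h13 : Nat.card H₁ * Nat.card H₃ + 2 * p ≤ (p + 1) * (p ^ 2 - 1) := by
    by_contra h
    exact hw (Or.inl (not_le.1 h)) hdes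
  have h12 : Nat.card H₁ * Nat.card H₂ + 2 * p ≤ (p + 1) * (p ^ 2 - 1) := by
    by_contra h
    exact hw (Or.inr (Or.inl (not_le.1 h))) hdes
  have h23 : Nat.card H₂ * Nat.card H₃ + 2 * p ≤ (p + 1) * (p ^ 2 - 1) := by
    by_contra h
    exact hw (Or.inr (Or.inr (not_le.1 h))) hdes
  rcases hsmall with h | h | h
  · exact natCast_mul_le_floor_of_wall hp3 h h23
  · have e : Nat.card H₁ * Nat.card H₂ * Nat.card H₃ = Nat.card H₂ * Nat.card H₁ * Nat.card H₃ := by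
      ring
    rw [e]
    exact natCast_mul_le_floor_of_wall hp3 h h13
  · have e : Nat.card H₁ * Nat.card H₂ * Nat.card H₃ = Nat.card H₃ * Nat.card H₁ * Nat.card H₂ := by
      ring
    rw [e]
    exact natCast_mul_le_floor_of_wall hp3 h h12

omit hp in
/-- Arithmetic of the upper window: `p ≥ 2`, `p + 1 ≤ d` and the wall `c d + 2p ≤ (p+1)(p²-1)`
give `c ≤ p² - 3` (`(p²-2)(p+1) + 2p = p³ + p² - 2 > (p+1)(p²-1)`). -/
theorem le_sq_sub_three_of_wall (hp2 : 2 ≤ p) {c d : ℕ} (hd : p + 1 ≤ d)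
    (hw : c * d + 2 * p ≤ (p + 1) * (p ^ 2 - 1)) : c ≤ p ^ 2 - 3 := by
  have hp21 : 1 ≤ p ^ 2 := Nat.one_le_pow _ _ (by omega)
  have h4 : 4 ≤ p ^ 2 := by nlinarith
  by_contra h
  have hc : p ^ 2 ≤ c + 2 := by omega
  have hwR : (c : ℝ) * d + 2 * p ≤ ((p : ℝ) + 1) * ((p : ℝ) ^ 2 - 1) := by
    have h' := (Nat.cast_le (α := ℝ)).2 hw
    push_cast [Nat.cast_sub hp21] at h'
    exact h'
  have hcR : (p : ℝ) ^ 2 ≤ c + 2 := by exact_mod_cast hc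
  have hdR : (p : ℝ) + 1 ≤ d := by exact_mod_cast hd
  have hpR : (2 : ℝ) ≤ p := by exact_mod_cast hp2
  have hc0 : (0 : ℝ) ≤ (p : ℝ) ^ 2 - 2 := by nlinarith
  have hm : ((p : ℝ) ^ 2 - 2) * ((p : ℝ) + 1) ≤ (c : ℝ) * d :=
    mul_le_mul (by linarith) hdR (by linarith) (by linarith)
  nlinarith

/-- **THE ORDER WINDOW OF A `(2,1)` WITNESS** (`p ≥ 3`).  If a subgroup-TPP triple of `GL₂(𝔽_p)`
with a level-one identity design satisfies the crux inequality at some `-2 < ε ≤ 1`, then every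
member has `p + 1 ≤ |Hᵢ| ≤ p² - 3` (lower end: `no_levelOne_witness_of_small_member`; upper end:
the wall against a partner of order `≥ p + 1`). -/
theorem levelOne_witness_window (hp3 : 3 ≤ p) {ε : ℝ} (hε : -2 < ε) (hε1 : ε ≤ 1)
    {H₁ H₂ H₃ : Subgroup (GLm p 2)} (htpp : SubgroupTPP H₁ H₂ H₃)
    (hdes : ∃ c : Matrix (Fin 2) (Fin 2) (ZMod p) → ℂ, (∀ M, 1 < M.rank → c M = 0) ∧
      (∑ M, c M * ZMod.stdAddChar (Matrix.trace (M * ((1 : GLm p 2) : Mat p 2)))) = 1 ∧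
      ∀ a ∈ H₁, ∀ b ∈ H₂, ∀ g ∈ H₃, a * b * g ≠ 1 →
        (∑ M, c M * ZMod.stdAddChar
          (Matrix.trace (M * ((a * b * g : GLm p 2) : Mat p 2)))) = 0)
    (hlt : budget p 2 1 (2 + ε) <
      ((Nat.card H₁ * Nat.card H₂ * Nat.card H₃ : ℕ) : ℝ) ^ ((2 + ε) / 3)) :
    (p + 1 ≤ Nat.card H₁ ∧ Nat.card H₁ ≤ p ^ 2 - 3) ∧
      (p + 1 ≤ Nat.card H₂ ∧ Nat.card H₂ ≤ p ^ 2 - 3) ∧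
      (p + 1 ≤ Nat.card H₃ ∧ Nat.card H₃ ≤ p ^ 2 - 3) := by
  have hbig : ¬ (Nat.card H₁ ≤ p ∨ Nat.card H₂ ≤ p ∨ Nat.card H₃ ≤ p) :=
    fun h => no_levelOne_witness_of_small_member hp3 hε hε1 htpp hdes h hlt
  push Not at hbig
  obtain ⟨hc1, hc2, hc3⟩ := hbig
  have hw := StandardLines.no_levelOne_design_of_walls H₁ H₂ H₃ htpp
  have h13 : Nat.card H₁ * Nat.card H₃ + 2 * p ≤ (p + 1) * (p ^ 2 - 1) := by
    by_contra h
    exact hw (Or.inl (not_le.1 h)) hdes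
  have h12 : Nat.card H₁ * Nat.card H₂ + 2 * p ≤ (p + 1) * (p ^ 2 - 1) := by
    by_contra h
    exact hw (Or.inr (Or.inl (not_le.1 h))) hdes
  have h21 : Nat.card H₂ * Nat.card H₁ + 2 * p ≤ (p + 1) * (p ^ 2 - 1) := by
    rw [mul_comm]
    exact h12
  have h31 : Nat.card H₃ * Nat.card H₁ + 2 * p ≤ (p + 1) * (p ^ 2 - 1) := by
    rw [mul_comm]
    exact h13
  have hp2 : 2 ≤ p := by omega
  exact ⟨⟨by omega, le_sq_sub_three_of_wall hp2 (by omega) h12⟩,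
    ⟨by omega, le_sq_sub_three_of_wall hp2 (by omega) h21⟩,
    ⟨by omega, le_sq_sub_three_of_wall hp2 (by omega) h31⟩⟩

end LevelOneFloor

end Summit.MatrixMultiplication.MatrixMultiplication.Theorems.SubgroupIdentityDesigns.Negative
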